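import Summits.QuantumFields.BalabanUV.T4Continuum.Spine.NE5.TwoRunTorusNE5Usable

/-!
# Spine/NE5/TwoRunTorusNE5Fires — THE END OF ROW NE5 FIRES: the usable minimal END (T43) instantiated on an explicit
# producer in the (v)⁺ currency — a one-bond record whose Γ-kernel MOVES along the two-run pencil at the only slope
# the window allows — with every one of its ≈ 40 structural ∀-binders discharged (cell `pub-balaban-gaps`, seat `ne5`
# gen 13; the structural twin of T41's real-number non-vacuity)

WHY.  T41∕T43 reduce `T4OutputRate.NE5` on the torus carriers to a list of STRUCTURAL hypotheses on per-scale, per-term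
data (torus models, τ-regions, contour radius, parameter lists, walk records `TermKernels` at `c⁺` with `TermWalkData`
for the exported packages `w j`, `Γ` linear in the kernel, `χ ∕ χᶜ` with (2.22), potentials with (2.20), σ- and
b-holomorphy, measurability, symmetry, fibre ∕ size bounds, activities = Σ (2.14)-terms, outputs by (2.13)).  Nobody
had ever INSTANTIATED that list: with ≈ 40 interlocking binders (dependent types through `(𝒦 j Z t φ).Λ`, instance
binders, lists enumerating `Z ∖ cl(Z₀)`, the exported letters fixed by the ∃) a hidden incompatibility would make the
END vacuous — located point (x14) WAS one (T41's export omitted `1 ≤ κ₁`; repaired in T43).  THIS FILE instantiates it.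
§1 `toyStep`: a one-configuration two-torus step (spaces = the whole configuration type).  §2 one-walk expansions:
`jointWalkExpansion_single` ∕ `walkMajorants_single` — a σ-constant kernel family, entrywise holomorphic on the `R`-ball
and bounded there by `K̄·e^{−(κ+ε)d₁}` (resp. `K̄·e^{−κd₁}`), IS a `JointWalkExpansion` (resp. `WalkMajorants`) with the
one-element walk family (amplitude `K̄`, walk distance `d₁`, rate `κ+ε`).  §3 `pencilKernels c x₀ g`: ONE row bond at
`x₀`, no extra column, precision `A ≡ 1`, Γ-kernel `G(σ,b) = b·g` — AFFINE ALONG THE PENCIL `b` with slope `g` — and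
`termWalkData_pencilKernels`: it carries `TermWalkData … w` for every package with `R > 0`, `K̄_Γ ≥ 0`, `K̄_E, K̄_C ≥ 1`
PROVIDED the slope is `g = K̄_Γ ∕ R` (the bound `‖b·g‖ ≤ K̄_Γ` on the `R`-ball forces `|g| ≤ K̄_Γ∕R`:
`slope_le_of_ball_bound`).  Since the END's window asks `R_j > α_j ≥ s∕θ^j`, the producer's two-run difference
`G(σ,1) − G(σ,0) = g_j < K̄_Γθ^j∕s` is GEOMETRICALLY SMALL (`slope_lt_rate`) — the toy shows in two lines what gate (b)
(rows NE2∕NE3) means for a producer: the window is affordable exactly when the two runs' kernels are `O(θ^j)`-close.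
§4 `end_fires`: T43 `ne5_of_structural_data_usable_abs` (letters
`K̄_Γ = K̄_E = K̄_C = ε = κ = 1`, `m = n_Λ = n_N = 1`, `R_σ0 = 0`) APPLIED to: `L = c.L`, one cube per direction at every
scale, `toyStep`, τ-regions `univ`, `r = e^{κ₁} − 1 > 0` (exported `1 ≤ κ₁`), lists by `Finset.toList`, records
`pencilKernels c⁺ x₀ (1∕R_j)`, `Γ` = the kernel's linear map, `χ ≡ 1` and `χᶜ = e^{−½γ₂r_P²|P|}` (the (2.22) weight
itself, so the (2.14)-integrand does NOT vanish and the activities inherit the b-dependence of `Γ`), `𝐃 = ∅`, `𝐕_k = 0`,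
`q_P = 0`, `w₂₀ = 0`, activities ∕ outputs BY their defining sums — conclusion `T4OutputRate.NE5` for the toy read-outs.  The statement is
weak by design (an ∃ over carriers); the PROOF TERM is the certificate that the END's hypothesis list is jointly
satisfiable by b-DEPENDENT data and that its exported letters are usable as typed.

HONEST FRAMING.  Consistency ∕ usability certificate over landed shapes; the toy producer is NOT Bałaban's (his records
are NODE O's (v)⁺ with rows NE2∕NE3's two-run rate); nothing of Bałaban's is constructed or asserted beyond print.  NE5
NOT PRINTED ∕ NOT PROVED; leaves 0∕12; (D4) 0∕1; spine 0∕9.  Rung (B)+1 on a FIXED finite T⁴ — NOT continuum, NOT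
infinite volume, NOT mass gap, NOT Clay.  HONEST DEPENDENCY: continuum YM on T⁴ ⇐ BetaPertH ∧ nine spine estimates;
BetaPertH ⇐ (D1) ∧ (D4) ∧ CAP+tail.  0 sorry; 2 toy `def`s (`toyStep`, `pencilKernels`) + 6 theorems, no new named fact.

Sources: [II] = T. Bałaban, CMP **116** (1988) [Balaban1988RG2Cluster] (2.13)–(2.26) pp. 14–17, (1.11) p. 5, p. 13,
p. 15; [I] = CMP **109** (1987) [Balaban1987RG1] (0.24)–(0.25) p. 257; [B9] = CMP **99** (1985)
[Balaban1985BackgroundPropagators] Thm 3.10 (3.107)–(3.108) p. 416; C. King, CMP **102** (1986) [King1986] p. 665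
(«a difference of propagators on one line»).  Nothing here is a claim about the Yang–Mills mass gap.
-/

noncomputable section

namespace Summit.QuantumFields.BalabanUV.T4Continuum.Spine.NE5.TwoRunTorusNE5Fires

open Matrix Metric Set Finset
open Literature.MathematicalPhysics.QuantumFieldTheory.Balaban1983to89
open Literature.MathematicalPhysics.QuantumFieldTheory.Balaban1983to89.T4OutputRate (NE5)
open Literature.MathematicalPhysics.QuantumFieldTheory.Balaban1983to89.TreeLengthTorus (TPt TDom tsys)
open Literature.MathematicalPhysics.QuantumFieldTheory.Balaban1983to89.TreeLengthTorusGeometry (TTouch)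
open Literature.MathematicalPhysics.QuantumFieldTheory.Balaban1983to89.TreeLengthTorusTransfer (tclosure)
open Literature.MathematicalPhysics.QuantumFieldTheory.Balaban1983to89.B13Lemma3TorusData (TBond)
open Literature.MathematicalPhysics.QuantumFieldTheory.Balaban1983to89.B13Lemma3Torus (TwoTorusStep)
open Literature.MathematicalPhysics.QuantumFieldTheory.Balaban1983to89.B13Lemma3TorusTerms (terms Z0)
open Literature.MathematicalPhysics.QuantumFieldTheory.Balaban1983to89.B13Term214 (core214 F214 term214)
open Literature.MathematicalPhysics.QuantumFieldTheory.Balaban1983to89.B5TorusCover (UT)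
open Literature.MathematicalPhysics.QuantumFieldTheory.Balaban1983to89.B13Resummation (locE)
open Literature.MathematicalPhysics.QuantumFieldTheory.Balaban1983to89.B9Thm37GlueTorus (tdist1 tdist1_self tdist1_nonneg)
open Literature.MathematicalPhysics.QuantumFieldTheory.Balaban1983to89.B13JointWalkExpansion
  (JointWalkExpansion WalkMajorants)
open Literature.MathematicalPhysics.QuantumFieldTheory.Balaban1983to89.B13TermWalkData
  (WalkConsts TermKernels TermWalkData)
open Summit.QuantumFields.BalabanUV.T4Continuum.Spine.NE5.TwoRunTorusNE5 (torusCarriers reFunctional)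
open Summit.QuantumFields.BalabanUV.T4Continuum.Spine.NE5.TwoRunTorusNE5Usable (ne5_of_structural_data_usable_abs)

/-! ## §1. A toy carrier -/

/-- **Toy two-torus step**: one configuration (`Φ = Unit`), no bonds, both spaces the whole configuration type, all
activities ∕ potentials zero, reader-owned predicates `True`.  A carrier for the END's conclusion; nothing of
Bałaban's. [folklore] -/
def toyStep (L N : ℕ) [NeZero L] [NeZero N] : TwoTorusStep 4 L N where
  volk := fun _ => 0
  Φ := Unit
  Bond := Fin 0
  finBond := inferInstance
  sp1 := fun _ => univ
  sp2 := fun _ => univ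
  Bv := fun _ _ => 0
  Vp := fun _ _ => 0
  V := fun _ _ => 0
  Q := fun _ _ _ _ => 0
  Vpp := fun _ _ => 0
  H := fun _ _ => 0
  Ek1 := fun _ _ => 0
  Elog := fun _ _ => 0
  Analytic := fun _ _ => True
  GaugeInv := fun _ => True
  Repr17 := True
  Restr := True

/-! ## §2. One-walk expansions -/

section Walks

variable {d N' ν : ℕ} {Nf : Fin ν → ℕ} [∀ i, NeZero (Nf i)]

/-- **A σ-constant kernel family, entrywise holomorphic on the `R`-ball and bounded there by `K̄·e^{−(κ+ε)·d₁(loc i,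
loc j)}`, is a `JointWalkExpansion` with the ONE-element walk family** (the family itself as the single term; amplitude
`K̄`, walk distance `d₁`, walk rate `κ + ε`, no σ-dependent walks).  The degenerate case of [B9] (3.107)–(3.108): a
series with one term. [cite: Balaban1985BackgroundPropagators, Thm 3.10 (3.107)–(3.108) p.416] -/
theorem jointWalkExpansion_single (c : B13.Consts) {p n : Type} (locp : p → UT Nf) (locn : n → UT Nf)
    (K2 : (TPt d N' → ℂ) → ℂ → Matrix p n ℂ) (X : Finset (UT Nf)) {R ε kap Kbar : ℝ} (hK : 0 ≤ Kbar)
    (hσ : ∀ σ : TPt d N' → ℂ, K2 σ 0 = K2 0 0)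
    (hhol : ∀ (σ : TPt d N' → ℂ) (i : p) (j : n), DifferentiableOn ℂ (fun u => K2 σ u i j) (ball (0 : ℂ) R))
    (hbd : ∀ (σ : TPt d N' → ℂ), ∀ u ∈ ball (0 : ℂ) R, ∀ (i : p) (j : n),
      ‖K2 σ u i j‖ ≤ Kbar * Real.exp (-((kap + ε) * tdist1 Nf (locp i) (locn j)))) :
    JointWalkExpansion c locp locn K2 X R ε kap Kbar (fun (_ : Unit) σ u => K2 σ u) ∅ (fun _ => Kbar)
      (fun _ a b => tdist1 Nf a b) (kap + ε) where
  hasSum := fun σ _ u _ i j => hasSum_unique fun _ : Unit => K2 σ u i j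
  termAnalytic := fun _ σ _ i j => hhol σ i j
  maj := fun _ σ _ u hu i j => hbd σ u hu i j
  majSum := fun S a b =>
    (Finset.sum_le_sum_of_subset_of_nonneg (Finset.subset_univ S)
      fun _ _ _ => mul_nonneg hK (Real.exp_nonneg _)).trans_eq (by
        rw [Finset.sum_const, Finset.card_univ, Fintype.card_unit, one_nsmul, add_sub_cancel_right])
  indep := fun _ _ σ _ => hσ σ
  through := fun ω h => absurd h (Set.notMem_empty ω)
  A_nonneg := fun _ => hK
  D_nonneg := fun _ a b => tdist1_nonneg a b

/-- **The same for `WalkMajorants`** (bound `K̄·e^{−κ·d₁}`, rate `κ`, no analyticity asked): one term.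
[cite: Balaban1985BackgroundPropagators, (3.108) p.416] -/
theorem walkMajorants_single (c : B13.Consts) {p n : Type} (locp : p → UT Nf) (locn : n → UT Nf)
    (K2 : (TPt d N' → ℂ) → ℂ → Matrix p n ℂ) {R kap Kbar : ℝ} (hK : 0 ≤ Kbar)
    (hbd : ∀ (σ : TPt d N' → ℂ), ∀ u ∈ ball (0 : ℂ) R, ∀ (i : p) (j : n),
      ‖K2 σ u i j‖ ≤ Kbar * Real.exp (-(kap * tdist1 Nf (locp i) (locn j)))) :
    WalkMajorants c locp locn K2 R kap Kbar (fun (_ : Unit) σ u => K2 σ u) (fun _ => Kbar)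
      (fun _ a b => tdist1 Nf a b) kap where
  hasSum := fun σ _ u _ i j => hasSum_unique fun _ : Unit => K2 σ u i j
  maj := fun _ σ _ u hu i j => hbd σ u hu i j
  majSum := fun S a b =>
    (Finset.sum_le_sum_of_subset_of_nonneg (Finset.subset_univ S)
      fun _ _ _ => mul_nonneg hK (Real.exp_nonneg _)).trans_eq (by
        rw [Finset.sum_const, Finset.card_univ, Fintype.card_unit, one_nsmul])
  A_nonneg := fun _ => hK

/-! ## §3. The one-bond record whose Γ-kernel moves along the pencil -/

/-- **The one-bond pencil record**: ONE row bond located at `x₀` (`Λ = Fin 1`), no extra column (`C₀ = Fin 0`),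
precision `A(σ,b) = 1`, Γ-kernel `G(σ,b) = b·g` — AFFINE ALONG THE TWO-RUN PENCIL `b` with slope `g` (run A at `b = 0`,
run B at `b = 1` differ by `g`) — references `Γ₀ = G(0,0) = 0`, `C = A(0,0)⁻¹ = 1 ≻ 0`, empty σ-region, fibre
number `1`.  A toy in the (v)⁺ currency, nothing of Bałaban's. [folklore] -/
def pencilKernels (c : B13.Consts) (d N' ν : ℕ) (Nf : Fin ν → ℕ) [∀ i, NeZero (Nf i)] (x₀ : UT Nf) (g : ℝ) :
    TermKernels c d N' ν Nf ℂ where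
  Λ := Fin 1
  instFintype := inferInstance
  instDecEq := inferInstance
  C₀ := Fin 0
  A2 := fun _ _ => 1
  G2 := fun _ u => fun _ _ => u * (g : ℂ)
  Γ₀ := 0
  C := 1
  locΛ := fun _ => x₀
  locN := fun _ => x₀
  X := ∅
  m := 1
  hfib := fun x => (Finset.card_filter_le _ _).trans (by simp)
  hG0 := by ext i j; simp
  hC0 := by
    show (1 : Matrix (Fin 1) (Fin 1) ℂ)⁻¹ = (1 : Matrix (Fin 1) (Fin 1) ℝ).map (algebraMap ℝ ℂ)
    rw [inv_one, Matrix.map_one _ (map_zero _) (map_one _)]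
  hC := Matrix.PosDef.one

/-- **The one-bond pencil record carries `TermWalkData` for every package with `R > 0`, `K̄_Γ ≥ 0`, `K̄_E, K̄_C ≥ 1`,
AT THE SLOPE `g = K̄_Γ ∕ R`** (one-walk expansions of §2 for the Γ-kernel `b·g` — `‖b·g‖ ≤ R·g = K̄_Γ` on the `R`-ball,
at walk distance `d₁(x₀, x₀) = 0` —, for the precision `1` and for the covariance `1⁻¹ = 1`; the geometric clause is over
the empty σ-region).  Read with the END's window `R_j > α_j ≥ s∕θ^j`: the affordable two-run difference is
`g_j < K̄_Γθ^j∕s`. [cite: Balaban1985BackgroundPropagators, Thm 3.10 p.416; King1986, p.665] -/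
theorem termWalkData_pencilKernels (c : B13.Consts) (x₀ : UT Nf) (w : WalkConsts) (hR : 0 < w.R)
    (hΓ : 0 ≤ w.KbarΓ) (hE : 1 ≤ w.KbarE) (hC : 1 ≤ w.KbarC) :
    TermWalkData (pencilKernels c d N' ν Nf x₀ (w.KbarΓ / w.R)) w := by
  have h0 : ∀ ρ : ℝ, Real.exp (-(ρ * tdist1 Nf x₀ x₀)) = 1 := fun ρ => by
    rw [tdist1_self, mul_zero, neg_zero, Real.exp_zero]
  have h1 : ∀ (K : ℝ) (i j : Fin 1), 1 ≤ K → ‖(1 : Matrix (Fin 1) (Fin 1) ℂ) i j‖ ≤ K := fun K i j hK => by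
    rw [Matrix.one_apply]
    split_ifs <;> simp [hK, zero_le_one.trans hK]
  refine ⟨⟨Unit, _, ∅, _, _, _, jointWalkExpansion_single c _ _ _ _ hΓ (fun σ => rfl)
      (fun σ i j => ?_) (fun σ u hu i j => ?_)⟩,
    ⟨Unit, _, ∅, _, _, _, jointWalkExpansion_single c _ _ _ _ (zero_le_one.trans hE) (fun σ => rfl)
      (fun σ i j => differentiableOn_const _) (fun σ u hu i j => ?_)⟩,
    ⟨Unit, _, _, _, _, walkMajorants_single c _ _ _ (zero_le_one.trans hC) (fun σ u hu i j => ?_)⟩,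
    fun b z hz => absurd hz (Finset.notMem_empty z)⟩
  · -- the Γ entry `u ↦ u·g` is entire
    exact (differentiableOn_id.mul_const _ :
      DifferentiableOn ℂ (fun u : ℂ => u * ((w.KbarΓ / w.R : ℝ) : ℂ)) (ball (0 : ℂ) w.R))
  · -- the Γ entry bound on the `R`-ball, at walk distance 0
    show ‖u * ((w.KbarΓ / w.R : ℝ) : ℂ)‖ ≤ w.KbarΓ * Real.exp (-((w.kap + w.ε) * tdist1 Nf x₀ x₀))
    rw [h0, mul_one, norm_mul, Complex.norm_real, Real.norm_of_nonneg (div_nonneg hΓ hR.le)]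
    calc ‖u‖ * (w.KbarΓ / w.R) ≤ w.R * (w.KbarΓ / w.R) := by
          gcongr
          exact (mem_ball_zero_iff.1 hu).le
      _ = w.KbarΓ := by field_simp
  · -- the precision entry bound
    show ‖(1 : Matrix (Fin 1) (Fin 1) ℂ) i j‖ ≤ w.KbarE * Real.exp (-((w.kap + w.ε) * tdist1 Nf x₀ x₀))
    rw [h0, mul_one]
    exact h1 _ i j hE
  · -- the covariance entry bound (`1⁻¹ = 1`)
    show ‖(1 : Matrix (Fin 1) (Fin 1) ℂ)⁻¹ i j‖ ≤ w.KbarC * Real.exp (-(w.kap * tdist1 Nf x₀ x₀))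
    rw [h0, mul_one, inv_one]
    exact h1 _ i j hC

/-- **Gate (b) in miniature, I — the walk bound on the `R`-ball forces the slope.**  If the b-affine entry `b·g` obeys
the (3.108)-type bound `‖b·g‖ ≤ K̄` for every `‖b‖ < R` (as `JointWalkExpansion.maj` asks of the one-walk family at
walk distance 0), then `|g| ≤ K̄ ∕ R`: the two runs `b = 0`, `b = 1` of such a record differ by at most `K̄ ∕ R`.
[folklore] -/
theorem slope_le_of_ball_bound {g K R : ℝ} (hR : 0 < R)
    (h : ∀ u : ℂ, ‖u‖ < R → ‖u * (g : ℂ)‖ ≤ K) : |g| ≤ K / R := by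
  have hK : 0 ≤ K := by simpa using h 0 (by simpa using hR)
  by_contra hlt
  push Not at hlt
  have hg : 0 < |g| := (div_nonneg hK hR.le).trans_lt hlt
  have hKR : K / |g| < R := by
    rw [div_lt_iff₀ hg]
    simpa [mul_comm] using (div_lt_iff₀ hR).1 hlt
  obtain ⟨ρ, hρ1, hρ2⟩ := exists_between hKR
  have hρ0 : 0 < ρ := (div_nonneg hK hg.le).trans_lt hρ1
  have hb := h (ρ : ℂ) (by rwa [Complex.norm_real, Real.norm_of_nonneg hρ0.le])
  rw [norm_mul, Complex.norm_real, Complex.norm_real, Real.norm_of_nonneg hρ0.le, Real.norm_eq_abs] at hb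
  have : K < ρ * |g| := by
    have := (div_lt_iff₀ hg).1 hρ1
    linarith [this]
  linarith

/-- **Gate (b) in miniature, II — the END's window makes the affordable slope geometrically small.**  With the
exported window `s∕θ^j ≤ α_j < R_j` (T43: `(w j).Admissible (α j) R_σ0` and `hαs`), a slope `|g| ≤ K̄ ∕ R_j` is
`< K̄θ^j∕s`: a producer meets the END's gate (b) exactly when its two runs' kernels are `O(θ^j)`-close — rows NE2∕NE3
(King, CMP 102 p. 665: «a difference of propagators on one line»). [folklore] -/
theorem slope_lt_rate {g K R α s θj : ℝ} (hK : 0 < K) (hs : 0 < s) (hθ : 0 < θj) (hαs : s / θj ≤ α) (hαR : α < R)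
    (hg : |g| ≤ K / R) : |g| < K * θj / s := by
  have hsθ : 0 < s / θj := div_pos hs hθ
  calc |g| ≤ K / R := hg
    _ < K / (s / θj) := div_lt_div_of_pos_left hK hsθ (hαs.trans_lt hαR)
    _ = K * θj / s := by field_simp

end Walks

/-! ## §4. The END fires -/

open Classical in
/-- **THE END FIRES.**  For every rate `θ > 0`, margin `s > 0` and coupling window `W′` there are constants `c` (with
`8 ≤ c.L`, `1 ≤ c.κ₁`), torus models indexed by the creation scale and an `E`-family on them — the (2.13)-outputs of
b-DEPENDENT (2.14)-activities — such that `T4OutputRate.NE5` holds for the two read-outs `E(·, 0)`, `E(·, 1)` at rate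
`θ`, decay `(1−10δ)½Lκ`, constant `2A₂C₃ε₁∕s`, OBTAINED BY APPLYING THE USABLE END T43
`ne5_of_structural_data_usable_abs` (letters `K̄_Γ = K̄_E = K̄_C = ε = κ = 1`, `m = n_Λ = n_N = 1`, `R_σ0 = 0`) TO THE
ONE-BOND PENCIL PRODUCER: `L = c.L`, one cube per direction at every scale, `toyStep`, τ-regions `univ`, contour
radius `r = e^{κ₁} − 1 > 0`, the parameter lists by `Finset.toList`, per scale the record `pencilKernels c⁺ x₀ (1∕R_j)`
(slope forced by the exported window: `R_j > α_j ≥ s∕θ^j`) with `termWalkData_pencilKernels`, `Γ` = the kernel's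
linear map, `χ ≡ 1`, `χᶜ = e^{−½γ₂r_P²|P|}` (the (2.22) weight: the integrand does not vanish), `𝐃 = ∅`, `𝐕_k = 0`,
`q_P = 0`, `w₂₀ = 0`, activities ∕ outputs by their defining sums —
every one of the END's ≈ 40 structural binders discharged in the proof term (fibre and size bounds non-vacuous:
one row per term, `|Z| ≥ 1`).  The statement is weak by design; the proof is the certificate that the END's hypothesis
list is jointly satisfiable by b-dependent data and its exported letters usable as typed.  (Honest: the toy producer
is not Bałaban's; leaves 0∕12.) [folklore] -/
theorem end_fires {θ s : ℝ} (hθ : 0 < θ) (hs : 0 < s) (W' : Set (ℕ → ℝ)) :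
    ∃ (c : B13.Consts) (L : ℕ) (_ : NeZero L) (N : ℕ → ℕ) (_ : ∀ j, NeZero (N j))
      (W : (j : ℕ) → TwoTorusStep 4 L (N j)) (E : (j : ℕ) → ℂ → TDom 4 (N j) → (W j).Φ → ℂ),
      8 ≤ c.L ∧ 1 ≤ c.κ₁ ∧
      NE5 (C := torusCarriers N W) (reFunctional N W fun j => E j 0) (reFunctional N W fun j => E j 1) W'
        ((1 - 10 * c.δ) * ((c.L : ℝ) / 2) * c.κ) θ (2 * (c.A₂ * c.C3act * c.ε₁) / s) := by
  obtain ⟨c, M, hMz, w, α, γ₂, rP, a₂₀, w₀, hL, hκ₁, -, hw, hα1, -, hlett, -, ha₂₀, hw₀, H⟩ :=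
    ne5_of_structural_data_usable_abs (ν := 1) (Nf := fun _ _ => 1) zero_le_one zero_le_one zero_le_one
      one_pos one_pos 1 (nΛ := 1) (nN := 1) zero_le_one zero_le_one hθ hs 0
  haveI hLz : NeZero c.L := ⟨by omega⟩
  have hr : 0 < Real.exp c.κ₁ - 1 := by linarith [Real.add_one_le_exp c.κ₁]
  have hR : ∀ j, 0 < (w j).R := fun j => one_pos.trans ((hα1 j).trans (hw j).hαR)
  -- the producer's records at `c⁺`: one row bond at the origin of the unit torus, slope `K̄_Γ ∕ R_j = 1 ∕ R_j`
  let x₀ : UT (fun _ : Fin 1 => 1) := UT.ofSite _ fun _ => (0 : Fin 1)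
  let 𝒦f : ℕ → TermKernels ({ c with κ₁ := c.κ₁ + 1 } : B13.Consts) 4 1 1 (fun _ => 1) ℂ :=
    fun j => pencilKernels _ 4 1 1 _ x₀ ((w j).KbarΓ / (w j).R)
  haveI hCf : ∀ j, Fintype (𝒦f j).C₀ := fun _ => show Fintype (Fin 0) from inferInstance
  haveI hCd : ∀ j, DecidableEq (𝒦f j).C₀ := fun _ => show DecidableEq (Fin 0) from inferInstance
  haveI hCe : ∀ j, IsEmpty (𝒦f j).C₀ := fun _ => Fin.isEmpty'
  have hcΛ : ∀ j, Fintype.card (𝒦f j).Λ = 1 := fun _ => Fintype.card_fin 1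
  have hcN : ∀ j, Fintype.card ((𝒦f j).Λ ⊕ (𝒦f j).C₀) = 1 := fun j => by
    rw [Fintype.card_sum, hcΛ, Fintype.card_eq_zero, add_zero]
  have h𝒦w : ∀ j, TermWalkData (𝒦f j) (w j) := fun j =>
    termWalkData_pencilKernels _ x₀ (w j) (hR j) (zero_le_one.trans (hlett j).1.ge) (hlett j).2.1.ge
      (hlett j).2.2.1.ge
  have hZ : ∀ Z : TDom 4 1, (1 : ℝ) ≤ 1 * ((Z.1).card : ℝ) := fun Z => by
    rw [one_mul]; exact Nat.one_le_cast.2 (Finset.card_pos.2 Z.2.1)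
  -- parameter lists, `Γ` = the kernel's linear map, activities and outputs BY their defining sums
  let lZ : (j : ℕ) → TDom 4 1 → Finset (TDom 4 (c.L * 1)) × Finset (TBond 4 M (c.L * 1)) → List (TPt 4 1) :=
    fun _ Z t => (Z.1 \ tclosure c.L 1 (Z0 M t)).toList
  let lD : ℕ → Finset (TDom 4 (c.L * 1)) × Finset (TBond 4 M (c.L * 1)) → List (TDom 4 (c.L * 1)) :=
    fun _ t => t.1.toList
  let Γ : (j : ℕ) → TDom 4 1 → Finset (TDom 4 (c.L * 1)) × Finset (TBond 4 M (c.L * 1)) → Unit → ℂ →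
      (TPt 4 1 → ℂ) → ((𝒦f j).Λ ⊕ (𝒦f j).C₀ → ℝ) → ((𝒦f j).Λ → ℂ) :=
    fun j _ _ _ b σ X => (𝒦f j).G2 σ b *ᵥ fun i => (X i : ℂ)
  let Hs : ℕ → ℂ → TDom 4 1 → Unit → ℂ := fun j b Z φ => ∑ t ∈ terms c.L M Z,
    term214 (Real.exp c.κ₁ - 1) (lZ j Z t) (lD j t) (core214 (fun σ => (𝒦f j).A2 σ b) (Γ j Z t φ b)
      (F214 t.2.card (fun _ => (1 : ℝ)) (fun _ => Real.exp (-(γ₂ / 2 * rP ^ 2 * (t.2.card : ℕ)))) ∅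
        (fun _ _ => (0 : ℂ)))) 0 0
  let Es : ℕ → ℂ → TDom 4 1 → Unit → ℂ := fun j b X φ =>
    locE (TTouch (d := 4) (N := 1)) (fun Z : TDom 4 1 => Z.1) (fun Z => Hs j b Z φ) X.1
  refine ⟨c, c.L, hLz, fun _ => 1, fun _ => inferInstance, fun _ => toyStep c.L 1, Es, hL, hκ₁,
    @H c.L hLz rfl (fun _ => 1) (fun _ => inferInstance) (fun _ => toyStep c.L 1)
      -- τ-regions `univ`; contour radius `e^{κ₁} − 1`
      (fun _ _ => univ) (fun _ _ => isOpen_univ) (fun _ _ => subset_univ _)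
      (Real.exp c.κ₁ - 1) hr le_rfl (fun _ _ _ _ => subset_univ _)
      -- parameter lists by `Finset.toList`
      lZ (fun j Z t => ⟨Finset.nodup_toList _, Finset.toList_toFinset _⟩)
      lD (fun j t => ⟨Finset.nodup_toList _, Finset.toList_toFinset _⟩)
      -- the records and their walk data
      (fun j _ _ _ => 𝒦f j) (fun j _ _ _ => hCf j) (fun j _ _ _ => hCd j) (fun j Z t _ φ _ => h𝒦w j)
      Γ (fun j Z t _ φ _ b _ σ _ X => rfl)
      -- `χ ≡ 1`, `χᶜ` = the (2.22) weight, `𝐃 = ∅`, `𝐕_k = 0`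
      (fun _ _ _ _ _ => 1) (fun _ _ t _ _ => Real.exp (-(γ₂ / 2 * rP ^ 2 * (t.2.card : ℕ))))
      (fun _ _ _ _ _ => zero_le_one) (fun _ _ _ _ _ => Real.exp_nonneg _)
      (fun _ _ _ => ∅) (fun _ _ _ _ _ _ _ => 0)
      -- σ-holomorphy (the kernels are σ-constant), b-holomorphy, measurability, symmetry
      (fun j Z t _ φ _ b _ i i' => differentiableOn_const _) (fun j Z t _ φ _ b _ i i' => differentiableOn_const _)
      (fun j Z t _ φ _ Y Bf => differentiableOn_const (0 : ℂ))
      (fun _ _ _ _ => measurable_const) (fun _ _ _ _ => measurable_const)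
      (fun j Z t _ φ _ b _ Y => measurable_const)
      (fun j Z t _ φ _ b _ σ _ => Matrix.isSymm_one)
      -- (2.22) with `q_P = 0`; (2.20) with `w₂₀ = 0`
      0 (fun _ _ _ _ _ => 0)
      (fun j Z t φ Bf => by rw [one_mul, mul_zero, add_zero])
      (fun j Z t φ Bf => Finset.sum_nonneg fun i _ => mul_self_nonneg (Bf i))
      (fun j Z t _ φ _ b _ τ _ Bf => by
        rw [Finset.sum_empty, add_zero]
        exact mul_nonneg (div_nonneg ha₂₀ zero_le_two) (Finset.sum_nonneg fun i _ => mul_self_nonneg (Bf i)))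
      (fun j Z => mul_nonneg hw₀.le (Nat.cast_nonneg _))
      -- fibre and size bounds: one row per term, `|Z| ≥ 1`
      (fun j Z t φ => le_rfl)
      (fun j Z t φ x => (Finset.card_filter_le _ _).trans (by rw [Finset.card_univ, hcN]))
      (fun j Z t φ => by rw [hcΛ, Nat.cast_one]; exact hZ Z)
      (fun j Z t φ => by rw [hcN, Nat.cast_one]; exact hZ Z)
      -- activities and outputs by their defining sums; the space restriction is trivial on `univ`
      Hs (fun j b _ Z φ _ => rfl) (fun j X Z φ _ _ => mem_univ _) Es (fun j b _ X φ _ => rfl) W'⟩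

end Summit.QuantumFields.BalabanUV.T4Continuum.Spine.NE5.TwoRunTorusNE5Fires

end
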